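import Literature.Geometry.Riemannian.PinchingEstimatesAlgebra
import Literature.Geometry.Riemannian.PinchingEstimatesKyFanMinimiser
import HarnessLib

/-!
# Hamilton's differential inequalities for `a₁ + a₂` and `a₁` at the minimisers (Hamilton 1986, Lemma 6.1)
(topic `Geometry/Riemannian`)

Part of the decomposition of `Literature.Geometry.Riemannian.hamilton_chenZhu_pinching`
(`PinchingEstimates.lean`), towards the proof of the ODE parts of Hamilton 1997, Thm. 1.2
(`a₁ + a₂ ≥ m` is preserved) and Thm. 1.6 (`a₁ + ρ ≥ 0` is preserved). Hamilton 1986, Lemma 6.1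
(p. 167): "`d a₁/dt ≥ a₁² + b₁² + 2a₂a₃` … To estimate the derivative of `a₁` we have to
evaluate `A² + BᵗB + 2A^#` at a unit eigenvector `x₁` where `A(x₁, x₁) = a₁`. Then
`A²(x₁, x₁) = a₁²`, `BᵗB(x₁, x₁) ≥ b₁²` … and `A^#(x₁, x₁) = a₂a₃`"; and 1997, p. 7: "From the
ordinary differential inequalities in [3], `d/dt (a₁ + a₂) ≥ a₁² + a₂² + 2(a₁ + a₂)a₃ + b₁² + b₂²`.
Now if `a₁ + a₂ ≥ m > 0` then `a₃ > 0` also."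

We PROVE the variational content of these two evaluations, without the spectral theorem: for a
symmetric `3 × 3` matrix `A` and any `B`,

* `field_pairSum_nonneg_of_isMinOn` — at an orthonormal pair `(u, v)` minimising
  `uᵀAu + vᵀAv` with positive minimum, `uᵀA'u + vᵀA'v ≥ 0` for `A' = A² + BᵗB + 2A^#`
  (first-order optimality makes `span(u, v)` invariant and `w = u × v` an eigenvector whose
  eigenvalue dominates; with the Cayley–Hamilton form of `A^#` one finds exactly Hamilton's
  `uᵀA'u + vᵀA'v = |Au|² + |Av|² + |ᵗBu|² + |ᵗBv|² + 2 (wᵀAw)(uᵀAu + vᵀAv) ≥ 0`);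
* `field_quad_nonneg_of_isMinOn` — at a unit `u` minimising `uᵀAu`, if `a₁ + a₂ > 0`
  (`Matrix.TwoSmallestEigenvaluesSumGE A m`, `m > 0`), then `uᵀA'u ≥ 0` (`u` is an eigenvector,
  `uᵀA^#u = det (A|u^⊥) > 0` as `A|u^⊥` is positive definite).

## References

* R. S. Hamilton, J. Differential Geom. 24 (1986), §6, Lemma 6.1 (p. 167), §2 (p. 157, `M^#`). [Hamilton1986]
* R. S. Hamilton, Comm. Anal. Geom. 5 (1997), §2.1, Thms. 1.2 and 1.6 (pp. 7, 10). [Hamilton1997]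
-/

noncomputable section

open Set Real
open scoped Matrix BigOperators

namespace Literature.Geometry.Riemannian

namespace HamiltonODE

/-! ### Linear algebra in `ℝ³` -/

section Tools

variable (A : Matrix (Fin 3) (Fin 3) ℝ)

/-- For symmetric `A`, `uᵀA²u = |Au|²`. [folklore] -/
theorem quad_mul_self_of_isSymm {A : Matrix (Fin 3) (Fin 3) ℝ} (hA : A.IsSymm) (u : Fin 3 → ℝ) :
    u ⬝ᵥ ((A * A) *ᵥ u) = (A *ᵥ u) ⬝ᵥ (A *ᵥ u) := by
  rw [← Matrix.mulVec_mulVec, Matrix.dotProduct_mulVec, ← Matrix.mulVec_transpose, hA.eq]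

/-- `uᵀ(BᵗB)u = |ᵗBu|²`. [folklore] -/
theorem quad_mul_transpose_self (B : Matrix (Fin 3) (Fin 3) ℝ) (u : Fin 3 → ℝ) :
    u ⬝ᵥ ((B * Bᵀ) *ᵥ u) = (Bᵀ *ᵥ u) ⬝ᵥ (Bᵀ *ᵥ u) := by
  rw [← Matrix.mulVec_mulVec, Matrix.dotProduct_mulVec, ← Matrix.mulVec_transpose]

/-- Quadratic forms only see the symmetric part: `uᵀ(ᵗM)u = uᵀMu`; in particular
`uᵀA^#u = uᵀ(adj A)u`. [folklore] -/
theorem quad_sharp (M : Matrix (Fin 3) (Fin 3) ℝ) (u : Fin 3 → ℝ) :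
    u ⬝ᵥ (M.sharp *ᵥ u) = u ⬝ᵥ (M.adjugate *ᵥ u) := by
  rw [Matrix.sharp, Matrix.dotProduct_transpose_mulVec]

/-- **Cayley–Hamilton form of the adjugate** of a `3 × 3` matrix:
`adj X = X² - (tr X) X + ½((tr X)² - tr X²)·1`. [folklore] -/
theorem adjugate_eq_cayleyHamilton (X : Matrix (Fin 3) (Fin 3) ℝ) :
    X.adjugate = X * X - X.trace • X + ((X.trace ^ 2 - (X * X).trace) / 2) • (1 : Matrix _ _ ℝ) := by
  ext i j
  simp only [Matrix.adjugate_fin_three, Matrix.sub_apply, Matrix.add_apply, Matrix.smul_apply,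
    Matrix.mul_apply, Fin.sum_univ_three, Matrix.trace_fin_three, smul_eq_mul, Matrix.one_apply]
  fin_cases i <;> fin_cases j <;> simp <;> ring

/-- The quadratic form of the adjugate at a unit vector:
`uᵀ(adj A)u = uᵀA²u - (tr A) uᵀAu + ½((tr A)² - tr A²)`. [folklore] -/
theorem quad_adjugate (u : Fin 3 → ℝ) (hu : u ⬝ᵥ u = 1) :
    u ⬝ᵥ (A.adjugate *ᵥ u) =
      u ⬝ᵥ ((A * A) *ᵥ u) - A.trace * (u ⬝ᵥ (A *ᵥ u)) + (A.trace ^ 2 - (A * A).trace) / 2 := by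
  rw [adjugate_eq_cayleyHamilton]
  simp only [Matrix.add_mulVec, Matrix.sub_mulVec, Matrix.smul_mulVec, Matrix.one_mulVec,
    dotProduct_add, dotProduct_sub, dotProduct_smul, smul_eq_mul, hu, mul_one]

/-- **Parseval in an orthonormal basis of `ℝ³`**: `|y|² = (u·y)² + (v·y)² + (w·y)²`. [folklore] -/
theorem parseval_of_orthonormal {u v w : Fin 3 → ℝ} (hu : u ⬝ᵥ u = 1) (hv : v ⬝ᵥ v = 1)
    (hw : w ⬝ᵥ w = 1) (huv : u ⬝ᵥ v = 0) (huw : u ⬝ᵥ w = 0) (hvw : v ⬝ᵥ w = 0)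
    (y : Fin 3 → ℝ) : y ⬝ᵥ y = (u ⬝ᵥ y) ^ 2 + (v ⬝ᵥ y) ^ 2 + (w ⬝ᵥ y) ^ 2 := by
  set R : Matrix (Fin 3) (Fin 3) ℝ := Matrix.of ![u, v, w] with hR
  simp only [dotProduct, Fin.sum_univ_three] at hu hv hw huv huw hvw
  have hRRt : R * Rᵀ = 1 := by
    ext i j
    fin_cases i <;> fin_cases j <;>
      simp [R, Matrix.mul_apply, Fin.sum_univ_three] <;> linarith
  have hRtR : Rᵀ * R = 1 := mul_eq_one_comm.1 hRRt
  have key : (R *ᵥ y) ⬝ᵥ (R *ᵥ y) = y ⬝ᵥ y := by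
    rw [Matrix.dotProduct_mulVec, ← Matrix.mulVec_transpose, Matrix.mulVec_mulVec, hRtR,
      Matrix.one_mulVec]
  rw [← key]
  simp only [Matrix.mulVec, dotProduct, Fin.sum_univ_three, R, Matrix.of_apply, Matrix.cons_val]
  ring

/-- The elementary fact behind first-order optimality on spheres: if
`2tX + t²D ≥ 0` for all real `t`, then `X = 0`. [folklore] -/
theorem eq_zero_of_forall_quad_nonneg {X D : ℝ} (h : ∀ t : ℝ, 0 ≤ 2 * t * X + t ^ 2 * D) :
    X = 0 := by
  by_contra hX
  have hc : 0 < |D| + 1 := by positivity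
  have := h (-X / (|D| + 1))
  have hX2 : 0 < X ^ 2 := by positivity
  have key : 2 * (-X / (|D| + 1)) * X + (-X / (|D| + 1)) ^ 2 * D =
      X ^ 2 / (|D| + 1) ^ 2 * (D - 2 * (|D| + 1)) := by
    field_simp
    ring
  rw [key] at this
  have : D - 2 * (|D| + 1) < 0 := by linarith [le_abs_self D]
  nlinarith [div_pos hX2 (pow_pos hc 2)]

variable {A}

/-- **Variation along a great circle.** For symmetric `A`, unit `u`, and unit `y ⊥ u`, the unit
vector `(u + ty)/√(1 + t²)` has `A`-value `(uᵀAu + 2t uᵀAy + t² yᵀAy)/(1 + t²)`. [folklore] -/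
theorem quad_add_smul {A : Matrix (Fin 3) (Fin 3) ℝ} (hA : A.IsSymm) (u y : Fin 3 → ℝ) (t : ℝ) :
    (u + t • y) ⬝ᵥ (A *ᵥ (u + t • y)) =
      u ⬝ᵥ (A *ᵥ u) + 2 * t * (u ⬝ᵥ (A *ᵥ y)) + t ^ 2 * (y ⬝ᵥ (A *ᵥ y)) := by
  have hs := quad_comm_of_isSymm hA y u
  simp only [Matrix.mulVec_add, Matrix.mulVec_smul, dotProduct_add, dotProduct_smul, add_dotProduct,
    smul_dotProduct, smul_eq_mul, hs]
  ring

/-- The normalised great-circle point is a unit vector: `|u + ty|² = 1 + t²` for unit `u ⊥ y`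
unit. [folklore] -/
theorem norm_sq_add_smul {u y : Fin 3 → ℝ} (hu : u ⬝ᵥ u = 1) (hy : y ⬝ᵥ y = 1) (huy : u ⬝ᵥ y = 0)
    (t : ℝ) : (u + t • y) ⬝ᵥ (u + t • y) = 1 + t ^ 2 := by
  simp only [dotProduct_add, dotProduct_smul, add_dotProduct, smul_dotProduct, smul_eq_mul, hu, hy,
    huy, dotProduct_comm y u]
  ring

/-- Scaling a vector scales its quadratic form quadratically. [folklore] -/
theorem quad_smul (M : Matrix (Fin 3) (Fin 3) ℝ) (c : ℝ) (z : Fin 3 → ℝ) :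
    (c • z) ⬝ᵥ (M *ᵥ (c • z)) = c ^ 2 * (z ⬝ᵥ (M *ᵥ z)) := by
  simp only [Matrix.mulVec_smul, dotProduct_smul, smul_dotProduct, smul_eq_mul]; ring

/-- **First- and second-order optimality on the sphere.** If unit `u` minimises `zᵀAz` among
the unit vectors `(u + ty)/√(1+t²)` for a fixed unit `y ⊥ u` (`A` symmetric), then `uᵀAy = 0` and
`yᵀAy ≥ uᵀAu`. [folklore] -/
theorem firstOrder_of_min {A : Matrix (Fin 3) (Fin 3) ℝ} (hA : A.IsSymm) {u y : Fin 3 → ℝ}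
    (hmin : ∀ t : ℝ, u ⬝ᵥ (A *ᵥ u) ≤
      ((1 + t ^ 2)⁻¹.sqrt • (u + t • y)) ⬝ᵥ (A *ᵥ ((1 + t ^ 2)⁻¹.sqrt • (u + t • y)))) :
    u ⬝ᵥ (A *ᵥ y) = 0 ∧ u ⬝ᵥ (A *ᵥ u) ≤ y ⬝ᵥ (A *ᵥ y) := by
  have hq : ∀ t : ℝ, 0 ≤ 2 * t * (u ⬝ᵥ (A *ᵥ y)) + t ^ 2 * (y ⬝ᵥ (A *ᵥ y) - u ⬝ᵥ (A *ᵥ u)) := by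
    intro t
    have h := hmin t
    have ht : 0 < 1 + t ^ 2 := by positivity
    rw [quad_smul, Real.sq_sqrt (inv_nonneg.2 ht.le), quad_add_smul hA, ← div_eq_inv_mul,
      le_div_iff₀ ht] at h
    nlinarith
  have hX := eq_zero_of_forall_quad_nonneg hq
  refine ⟨hX, ?_⟩
  have := hq 1
  rw [hX] at this
  linarith

end Tools

/-! ### Hamilton's inequality for `a₁ + a₂` at a minimising pair -/

/-- **`d/dt (a₁ + a₂) ≥ 0` at the minimiser when `a₁ + a₂ > 0`** (the variational content of
Hamilton 1997, p. 7 / 1986, Lemma 6.1): for symmetric `A` and any `B`, if the orthonormal pair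
`(u, v)` minimises `uᵀAu + vᵀAv` among the orthonormal pairs `((u + tw)/√(1+t²), v)` and
`(u, (v + tw)/√(1+t²))` (`w` a unit vector orthogonal to both) and `uᵀAu + vᵀAv > 0`, then
`uᵀA'u + vᵀA'v ≥ 0` for `A' = A² + BᵗB + 2A^#`; in fact
`uᵀA'u + vᵀA'v = |Au|² + |Av|² + |ᵗBu|² + |ᵗBv|² + 2(wᵀAw)(uᵀAu + vᵀAv)` with `wᵀAw ≥ uᵀAu, vᵀAv`
(Hamilton: `a₁² + a₂² + 2(a₁ + a₂)a₃ + b₁² + b₂²`). [cite: Hamilton1997, §2.1, Thm. 1.2 (proof, p. 7)] -/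
theorem field_pairSum_nonneg_of_min {A B : Matrix (Fin 3) (Fin 3) ℝ} (hA : A.IsSymm)
    {u v w : Fin 3 → ℝ} (hu : u ⬝ᵥ u = 1) (hv : v ⬝ᵥ v = 1) (hw : w ⬝ᵥ w = 1) (huv : u ⬝ᵥ v = 0)
    (huw : u ⬝ᵥ w = 0) (hvw : v ⬝ᵥ w = 0)
    (hminu : ∀ t : ℝ, u ⬝ᵥ (A *ᵥ u) ≤
      ((1 + t ^ 2)⁻¹.sqrt • (u + t • w)) ⬝ᵥ (A *ᵥ ((1 + t ^ 2)⁻¹.sqrt • (u + t • w))))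
    (hminv : ∀ t : ℝ, v ⬝ᵥ (A *ᵥ v) ≤
      ((1 + t ^ 2)⁻¹.sqrt • (v + t • w)) ⬝ᵥ (A *ᵥ ((1 + t ^ 2)⁻¹.sqrt • (v + t • w))))
    (hpos : 0 < u ⬝ᵥ (A *ᵥ u) + v ⬝ᵥ (A *ᵥ v)) :
    0 ≤ u ⬝ᵥ ((A * A + B * Bᵀ + (2 : ℝ) • A.sharp) *ᵥ u) +
      v ⬝ᵥ ((A * A + B * Bᵀ + (2 : ℝ) • A.sharp) *ᵥ v) := by
  obtain ⟨hXu, hWu⟩ := firstOrder_of_min hA hminu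
  obtain ⟨hXv, hWv⟩ := firstOrder_of_min hA hminv
  -- `|Aw|² = (wᵀAw)²` by Parseval, since `u·Aw = v·Aw = 0`
  have hAw : (A *ᵥ w) ⬝ᵥ (A *ᵥ w) = (w ⬝ᵥ (A *ᵥ w)) ^ 2 := by
    rw [parseval_of_orthonormal hu hv hw huv huw hvw (A *ᵥ w), hXu, hXv]
    ring
  -- traces in the orthonormal basis `(u, v, w)`
  have htr : A.trace = u ⬝ᵥ (A *ᵥ u) + v ⬝ᵥ (A *ᵥ v) + w ⬝ᵥ (A *ᵥ w) :=
    (sum_quadratic_eq_trace_of_orthonormal A hu hv hw huv huw hvw).symm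
  have htr2 : (A * A).trace =
      (A *ᵥ u) ⬝ᵥ (A *ᵥ u) + (A *ᵥ v) ⬝ᵥ (A *ᵥ v) + (w ⬝ᵥ (A *ᵥ w)) ^ 2 := by
    rw [← sum_quadratic_eq_trace_of_orthonormal (A * A) hu hv hw huv huw hvw,
      quad_mul_self_of_isSymm hA, quad_mul_self_of_isSymm hA, quad_mul_self_of_isSymm hA, hAw]
  -- the two quadratic forms of `A'`
  have eu : u ⬝ᵥ ((A * A + B * Bᵀ + (2 : ℝ) • A.sharp) *ᵥ u) = (A *ᵥ u) ⬝ᵥ (A *ᵥ u) +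
      (Bᵀ *ᵥ u) ⬝ᵥ (Bᵀ *ᵥ u) + 2 * ((A *ᵥ u) ⬝ᵥ (A *ᵥ u) - A.trace * (u ⬝ᵥ (A *ᵥ u)) +
        (A.trace ^ 2 - (A * A).trace) / 2) := by
    rw [Matrix.add_mulVec, Matrix.add_mulVec, dotProduct_add, dotProduct_add, Matrix.smul_mulVec,
      dotProduct_smul, smul_eq_mul, quad_sharp, quad_adjugate A u hu, quad_mul_self_of_isSymm hA,
      quad_mul_transpose_self]
  have ev : v ⬝ᵥ ((A * A + B * Bᵀ + (2 : ℝ) • A.sharp) *ᵥ v) = (A *ᵥ v) ⬝ᵥ (A *ᵥ v) +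
      (Bᵀ *ᵥ v) ⬝ᵥ (Bᵀ *ᵥ v) + 2 * ((A *ᵥ v) ⬝ᵥ (A *ᵥ v) - A.trace * (v ⬝ᵥ (A *ᵥ v)) +
        (A.trace ^ 2 - (A * A).trace) / 2) := by
    rw [Matrix.add_mulVec, Matrix.add_mulVec, dotProduct_add, dotProduct_add, Matrix.smul_mulVec,
      dotProduct_smul, smul_eq_mul, quad_sharp, quad_adjugate A v hv, quad_mul_self_of_isSymm hA,
      quad_mul_transpose_self]
  rw [eu, ev, htr2, htr]
  have h1 : 0 ≤ (A *ᵥ u) ⬝ᵥ (A *ᵥ u) := Finset.sum_nonneg fun i _ ↦ mul_self_nonneg _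
  have h2 : 0 ≤ (A *ᵥ v) ⬝ᵥ (A *ᵥ v) := Finset.sum_nonneg fun i _ ↦ mul_self_nonneg _
  have h3 : 0 ≤ (Bᵀ *ᵥ u) ⬝ᵥ (Bᵀ *ᵥ u) := Finset.sum_nonneg fun i _ ↦ mul_self_nonneg _
  have h4 : 0 ≤ (Bᵀ *ᵥ v) ⬝ᵥ (Bᵀ *ᵥ v) := Finset.sum_nonneg fun i _ ↦ mul_self_nonneg _
  have hWpos : 0 < w ⬝ᵥ (A *ᵥ w) := by linarith
  nlinarith [mul_pos hWpos hpos]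

/-! ### Hamilton's inequality for `a₁` at a minimising unit vector -/

/-- **`d a₁/dt ≥ 0` at the minimiser when `a₁ + a₂ > 0`** (the variational content of Hamilton
1997, Thm. 1.6, p. 10: "`d/dt a₁ ≥ a₁² + 2a₂a₃ + b₁²` and if `a₁ + a₂ > 0` then `a₂ > 0` and
`a₃ > 0`"; 1986, Lemma 6.1): for symmetric `A` with `a₁ + a₂ ≥ m > 0`
(`Matrix.TwoSmallestEigenvaluesSumGE`) and any `B`, if the unit vector `u` minimises `zᵀAz` over
unit `z`, then `uᵀA'u ≥ 0`, `A' = A² + BᵗB + 2A^#`: completing `u` to an orthonormal basis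
`(u, y, y')`, `u` is an eigenvector (`uᵀAy = uᵀAy' = 0`), `uᵀA^#u = (yᵀAy)(y'ᵀAy') - (yᵀAy')²` by
Cayley–Hamilton, and this is `> 0` because `zᵀAz > 0` for every unit `z ⊥ u`
(`2zᵀAz ≥ uᵀAu + zᵀAz ≥ m`). [cite: Hamilton1997, §2.1, Thm. 1.6 (proof, p. 10)] -/
theorem field_quad_nonneg_of_min {A B : Matrix (Fin 3) (Fin 3) ℝ} (hA : A.IsSymm) {m : ℝ}
    (hm : 0 < m) (hpair : A.TwoSmallestEigenvaluesSumGE m) {u : Fin 3 → ℝ} (hu : u ⬝ᵥ u = 1)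
    (hmin : ∀ z : Fin 3 → ℝ, z ⬝ᵥ z = 1 → u ⬝ᵥ (A *ᵥ u) ≤ z ⬝ᵥ (A *ᵥ z)) :
    0 ≤ u ⬝ᵥ ((A * A + B * Bᵀ + (2 : ℝ) • A.sharp) *ᵥ u) := by
  obtain ⟨y, y', hy, hy', huy, huy', hyy'⟩ := exists_orthonormal_complement hu
  -- great-circle variations towards any unit `z ⊥ u`
  have hvar : ∀ {z : Fin 3 → ℝ}, z ⬝ᵥ z = 1 → u ⬝ᵥ z = 0 → ∀ t : ℝ, u ⬝ᵥ (A *ᵥ u) ≤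
      ((1 + t ^ 2)⁻¹.sqrt • (u + t • z)) ⬝ᵥ (A *ᵥ ((1 + t ^ 2)⁻¹.sqrt • (u + t • z))) := by
    intro z hz huz t
    refine hmin _ ?_
    have ht : 0 < 1 + t ^ 2 := by positivity
    rw [dotProduct_smul, smul_dotProduct, smul_eq_mul, smul_eq_mul, norm_sq_add_smul hu hz huz,
      Real.sqrt_inv, ← mul_assoc, ← mul_inv, Real.mul_self_sqrt ht.le, inv_mul_cancel₀ ht.ne']
  obtain ⟨hX, hV⟩ := firstOrder_of_min hA (hvar hy huy)
  obtain ⟨hX', hW⟩ := firstOrder_of_min hA (hvar hy' huy')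
  -- positivity of `A` on `u^⊥`
  have hposz : ∀ {z : Fin 3 → ℝ}, z ⬝ᵥ z = 1 → u ⬝ᵥ z = 0 → 0 < z ⬝ᵥ (A *ᵥ z) := by
    intro z hz huz
    have h1 := hpair u z hu hz huz
    have h2 := hmin z hz
    linarith
  have hVpos : 0 < y ⬝ᵥ (A *ᵥ y) := hposz hy huy
  -- `VW - Z² > 0`: test `A` on the unit vector proportional to `Z y - V y'`
  have hdet : 0 < (y ⬝ᵥ (A *ᵥ y)) * (y' ⬝ᵥ (A *ᵥ y')) - (y ⬝ᵥ (A *ᵥ y')) ^ 2 := by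
    have hN : 0 < (y ⬝ᵥ (A *ᵥ y')) ^ 2 + (y ⬝ᵥ (A *ᵥ y)) ^ 2 := by positivity
    have hzz : ((y ⬝ᵥ (A *ᵥ y')) • y - (y ⬝ᵥ (A *ᵥ y)) • y') ⬝ᵥ
        ((y ⬝ᵥ (A *ᵥ y')) • y - (y ⬝ᵥ (A *ᵥ y)) • y') =
        (y ⬝ᵥ (A *ᵥ y')) ^ 2 + (y ⬝ᵥ (A *ᵥ y)) ^ 2 := by
      simp only [dotProduct_sub, sub_dotProduct, dotProduct_smul, smul_dotProduct, smul_eq_mul, hy,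
        hy', hyy', dotProduct_comm y' y]
      ring
    have hz1 : ((((y ⬝ᵥ (A *ᵥ y')) ^ 2 + (y ⬝ᵥ (A *ᵥ y)) ^ 2)⁻¹).sqrt •
        ((y ⬝ᵥ (A *ᵥ y')) • y - (y ⬝ᵥ (A *ᵥ y)) • y')) ⬝ᵥ
        ((((y ⬝ᵥ (A *ᵥ y')) ^ 2 + (y ⬝ᵥ (A *ᵥ y)) ^ 2)⁻¹).sqrt •
        ((y ⬝ᵥ (A *ᵥ y')) • y - (y ⬝ᵥ (A *ᵥ y)) • y')) = 1 := by
      rw [dotProduct_smul, smul_dotProduct, smul_eq_mul, smul_eq_mul, hzz, Real.sqrt_inv,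
        ← mul_assoc, ← mul_inv, Real.mul_self_sqrt hN.le, inv_mul_cancel₀ hN.ne']
    have huz : u ⬝ᵥ ((((y ⬝ᵥ (A *ᵥ y')) ^ 2 + (y ⬝ᵥ (A *ᵥ y)) ^ 2)⁻¹).sqrt •
        ((y ⬝ᵥ (A *ᵥ y')) • y - (y ⬝ᵥ (A *ᵥ y)) • y')) = 0 := by
      simp [dotProduct_smul, dotProduct_sub, huy, huy']
    have hq : ((y ⬝ᵥ (A *ᵥ y')) • y - (y ⬝ᵥ (A *ᵥ y)) • y') ⬝ᵥ
        (A *ᵥ ((y ⬝ᵥ (A *ᵥ y')) • y - (y ⬝ᵥ (A *ᵥ y)) • y')) =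
        (y ⬝ᵥ (A *ᵥ y)) * ((y ⬝ᵥ (A *ᵥ y)) * (y' ⬝ᵥ (A *ᵥ y')) - (y ⬝ᵥ (A *ᵥ y')) ^ 2) := by
      have hs := quad_comm_of_isSymm hA y' y
      simp only [Matrix.mulVec_sub, Matrix.mulVec_smul, dotProduct_sub, sub_dotProduct,
        dotProduct_smul, smul_dotProduct, smul_eq_mul, hs]
      ring
    have h := hposz hz1 huz
    rw [quad_smul, Real.sq_sqrt (inv_nonneg.2 hN.le), hq] at h
    have h' := (mul_pos_iff_of_pos_left (inv_pos.2 hN)).1 h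
    exact (mul_pos_iff_of_pos_left hVpos).1 h'
  -- `|Au|² = (uᵀAu)²`, `tr A`, `tr A²` in the basis `(u, y, y')`
  have hAu : (A *ᵥ u) ⬝ᵥ (A *ᵥ u) = (u ⬝ᵥ (A *ᵥ u)) ^ 2 := by
    rw [parseval_of_orthonormal hu hy hy' huy huy' hyy' (A *ᵥ u),
      quad_comm_of_isSymm hA y u, quad_comm_of_isSymm hA y' u, hX, hX']
    ring
  have hAy : (A *ᵥ y) ⬝ᵥ (A *ᵥ y) = (y ⬝ᵥ (A *ᵥ y)) ^ 2 + (y ⬝ᵥ (A *ᵥ y')) ^ 2 := by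
    rw [parseval_of_orthonormal hu hy hy' huy huy' hyy' (A *ᵥ y), hX,
      quad_comm_of_isSymm hA y' y]
    ring
  have hAy' : (A *ᵥ y') ⬝ᵥ (A *ᵥ y') = (y ⬝ᵥ (A *ᵥ y')) ^ 2 + (y' ⬝ᵥ (A *ᵥ y')) ^ 2 := by
    rw [parseval_of_orthonormal hu hy hy' huy huy' hyy' (A *ᵥ y'), hX']
    ring
  have htr : A.trace = u ⬝ᵥ (A *ᵥ u) + y ⬝ᵥ (A *ᵥ y) + y' ⬝ᵥ (A *ᵥ y') :=
    (sum_quadratic_eq_trace_of_orthonormal A hu hy hy' huy huy' hyy').symm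
  have htr2 : (A * A).trace = (u ⬝ᵥ (A *ᵥ u)) ^ 2 + (y ⬝ᵥ (A *ᵥ y)) ^ 2 +
      (y' ⬝ᵥ (A *ᵥ y')) ^ 2 + 2 * (y ⬝ᵥ (A *ᵥ y')) ^ 2 := by
    rw [← sum_quadratic_eq_trace_of_orthonormal (A * A) hu hy hy' huy huy' hyy',
      quad_mul_self_of_isSymm hA, quad_mul_self_of_isSymm hA, quad_mul_self_of_isSymm hA, hAu, hAy,
      hAy']
    ring
  have eu : u ⬝ᵥ ((A * A + B * Bᵀ + (2 : ℝ) • A.sharp) *ᵥ u) = (A *ᵥ u) ⬝ᵥ (A *ᵥ u) +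
      (Bᵀ *ᵥ u) ⬝ᵥ (Bᵀ *ᵥ u) + 2 * ((A *ᵥ u) ⬝ᵥ (A *ᵥ u) - A.trace * (u ⬝ᵥ (A *ᵥ u)) +
        (A.trace ^ 2 - (A * A).trace) / 2) := by
    rw [Matrix.add_mulVec, Matrix.add_mulVec, dotProduct_add, dotProduct_add, Matrix.smul_mulVec,
      dotProduct_smul, smul_eq_mul, quad_sharp, quad_adjugate A u hu, quad_mul_self_of_isSymm hA,
      quad_mul_transpose_self]
  rw [eu, hAu, htr2, htr]
  have h3 : 0 ≤ (Bᵀ *ᵥ u) ⬝ᵥ (Bᵀ *ᵥ u) := Finset.sum_nonneg fun i _ ↦ mul_self_nonneg _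
  nlinarith

end HamiltonODE

end Literature.Geometry.Riemannian

end
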